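import Literature.AlgebraicGeometry.HodgeTheory.FermatShiodaCondition
import HarnessLib

/-!
# Fermat characters of the four «preprint-only» split (3,3) ℚ(√−2) Hecke–Prym rows (WEIL-2 gen 32, FERMAT-G32 P.S. COROLLARY P; fact-free core)

research route, not a corollary; conditional on HC_CM plus one named minimal statement.

Cell `pub-hodge-ring2-ab-*` (ALL ABELIAN VARIETIES), seat WEIL-2 gen 32, account
`run/shared/lean/pub/pub-hodge-ring2/pub-hodge-ring2-ab-weil-2/FERMAT-G32.md` (§2 THEOREM F_q; P.S. COROLLARY P).

Informal setting (not formalised; the geometry has no carriers here).  The census of Weil-type Hecke–Prym families of the cell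
(ab-weil-1, census B) carries exactly four SPLIT `(3,3)` rows over `K = ℚ(√−2)` — `x8f16h6_01…04`, group `G = ℤ/16 ⋊ ⟨3⟩`, four branch points
on `ℙ¹` — whose only closing input in print is an unrefereed preprint (hyperbolic Weil sixfolds).  For each of them the `N = ℤ/16`-quotient
`X = C̃/N` is the ELLIPTIC curve `ℙ¹(4,2,4)` (the `⟨3⟩ ≅ ℤ/4`-cover of `ℙ¹` branched at the three `H`-type points), and `C̃ → X` is a
`μ₁₆`-cover with `b = 6` branch points whose exponent multiset is `{1,3,9,10,11,14}` (rows 01, 03) or `{2,5,6,7,13,15}` (rows 02, 04)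
(kit j178586, `code/g32/meta_q/`, `ℤ/16 ⋊ ⟨3⟩`, `t = 3`, genus `45`).  THEOREM F_q of the account (base genus `q = 1`) therefore makes Weil's
Hodge structure on `P_prim(C̃/X)` — and `W_K` of the row's `K`-piece by restriction and descent — algebraic as soon as the multiset is a
cycle character of the Fermat FOURFOLD `X⁴_16`; the theorems below certify (i) the Hodge condition and (ii) membership in every
`IsShiodaClosed` family by an explicit TYPE-I decomposition `surface # surface` ([Shioda 1979, Cor. (ii) p.182] / da Silva Cor. 2.3 (b):
drop a cancelling pair `(e, -e)` from the juxtaposition of two Hodge 4-sets), so that only Lefschetz (1,1) on `X²_16` and the inductive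
structure are invoked (the condition `(P_16)`, also kernel-proved in the tree, is not needed).  Helper `hash_eq` = the `hash` field with the
three multiset identities rewritten (the analogue of `star_eq` in `Ring2AbelianAllFermatQuotientCharactersSixfolds`).
0 sorry, no `def`, no named fact; `HC_CM` does not occur.  All proofs are `decide` on explicit finite data.
-/

open Multiset
open Literature.AlgebraicGeometry.HodgeTheory.FermatCharacter

namespace Summit.HodgeConjecture.Ring2AbelianAll.FermatQuotientCharactersSqrtMinusTwo

/-- Type-I step of the inductive structure (`β # γ`: Shioda 1979 Cor. (ii); da Silva Cor. 2.3 (b)), with the three multisets rewritten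
along `t + u = s`, `e ::ₘ t = et`, `(-e) ::ₘ u = eu`.  [cite: Shioda1979HodgeFermat, Cor. (ii) p.182]
research route, not a corollary; conditional on HC_CM plus one named minimal statement. -/
theorem hash_eq {m : ℕ} {C : Multiset (ZMod m) → Prop} (hC : IsShiodaClosed C) {e : ZMod m}
    {t u s et eu : Multiset (ZMod m)} (hs : t + u = s) (het : e ::ₘ t = et) (heu : (-e) ::ₘ u = eu)
    (h1 : IsHodgeMultiset et) (h2 : IsHodgeMultiset eu) (h3 : IsHodgeMultiset s)
    (c1 : 4 ≤ card et) (c2 : 4 ≤ card eu) (C1 : C et) (C2 : C eu) : C s := by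
  subst hs het heu
  exact hC.hash e t u h1 h2 h3 c1 c2 C1 C2

/-- `[1 3 9 10 11 14]`, `m = 16`: a Hodge multiset — a Hodge character of the Fermat fourfold `X⁴_16` (`b = 6`) for `α` and all its unit
multiples ⟺ Weil type `(3,3)` of the `ℚ(√−2)`-piece.  Rows x8f16h6_01 / _03 of census B (`ℤ/16 ⋊ ⟨3⟩`, `X = C̃/N` elliptic, 6 branch
points); NOT Schoen-simple (`15 ∉`).  [locator FERMAT-G32 P.S. COROLLARY P]
research route, not a corollary; conditional on HC_CM plus one named minimal statement. -/
theorem isHodgeMultiset_1_3_9_10_11_14 : IsHodgeMultiset ({1, 3, 9, 10, 11, 14} : Multiset (ZMod 16)) := by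
  unfold IsHodgeMultiset mNormSum; decide

/-- `[1 3 9 10 11 14]`, `m = 16`: in every `IsShiodaClosed` family via `surface[3,4,11,14] #_{e=4} surface[1,9,10,12]` (type I; Lefschetz
(1,1) on `X²_16` twice).  With `C = 𝔈_16`: the eigenlines `V(tα) ⊂ H⁴(X⁴_16; ℂ)` are algebraic — THEOREM F_1's cycle input for rows
x8f16h6_01 / _03.  [locator FERMAT-G32 §2 THEOREM F_q (e), P.S. COROLLARY P]
research route, not a corollary; conditional on HC_CM plus one named minimal statement. -/
theorem mem_of_isShiodaClosed_1_3_9_10_11_14 {C : Multiset (ZMod 16) → Prop} (hC : IsShiodaClosed C) :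
    C ({1, 3, 9, 10, 11, 14} : Multiset (ZMod 16)) :=
  hash_eq hC (e := 4) (t := {3, 11, 14}) (u := {1, 9, 10}) (et := {3, 4, 11, 14}) (eu := {1, 9, 10, 12})
    (by decide) (by decide) (by decide)
    (by unfold IsHodgeMultiset mNormSum; decide) (by unfold IsHodgeMultiset mNormSum; decide)
    (by unfold IsHodgeMultiset mNormSum; decide) (by decide) (by decide)
    (hC.surface {3, 4, 11, 14} (by unfold IsHodgeMultiset mNormSum; decide) (by decide))
    (hC.surface {1, 9, 10, 12} (by unfold IsHodgeMultiset mNormSum; decide) (by decide))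

/-- `[2 5 6 7 13 15]`, `m = 16`: a Hodge multiset (Weil type `(3,3)`).  Rows x8f16h6_02 / _04 of census B; NOT Schoen-simple.
[locator FERMAT-G32 P.S. COROLLARY P]
research route, not a corollary; conditional on HC_CM plus one named minimal statement. -/
theorem isHodgeMultiset_2_5_6_7_13_15 : IsHodgeMultiset ({2, 5, 6, 7, 13, 15} : Multiset (ZMod 16)) := by
  unfold IsHodgeMultiset mNormSum; decide

/-- `[2 5 6 7 13 15]`, `m = 16`: in every `IsShiodaClosed` family via `surface[4,6,7,15] #_{e=4} surface[2,5,12,13]` (type I; Lefschetz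
(1,1) on `X²_16` twice) — THEOREM F_1's cycle input for rows x8f16h6_02 / _04.  [locator FERMAT-G32 §2 THEOREM F_q (e), P.S. COROLLARY P]
research route, not a corollary; conditional on HC_CM plus one named minimal statement. -/
theorem mem_of_isShiodaClosed_2_5_6_7_13_15 {C : Multiset (ZMod 16) → Prop} (hC : IsShiodaClosed C) :
    C ({2, 5, 6, 7, 13, 15} : Multiset (ZMod 16)) :=
  hash_eq hC (e := 4) (t := {6, 7, 15}) (u := {2, 5, 13}) (et := {4, 6, 7, 15}) (eu := {2, 5, 12, 13})
    (by decide) (by decide) (by decide)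
    (by unfold IsHodgeMultiset mNormSum; decide) (by unfold IsHodgeMultiset mNormSum; decide)
    (by unfold IsHodgeMultiset mNormSum; decide) (by decide) (by decide)
    (hC.surface {4, 6, 7, 15} (by unfold IsHodgeMultiset mNormSum; decide) (by decide))
    (hC.surface {2, 5, 12, 13} (by unfold IsHodgeMultiset mNormSum; decide) (by decide))

end Summit.HodgeConjecture.Ring2AbelianAll.FermatQuotientCharactersSqrtMinusTwo
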